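import Summits.AtomisticToContinuum.BoseEinsteinCondensation.Theorems.SoloInformedTeleportation

/-!
# Hybrid Jastrow states — soft core plus positive-type tail — are Bose condensed, uniformly

Soloist report `solo-AtomisticToContinuum-informed`, `paper/sharpest.md` §4.8 (vii) (Theorem D′).

**Theorem D′ (continuum reading).** Let `u = u₁ + u₂` with `u₁` even, bounded, of positive type
(`û₁ ≥ 0`, self-energy `u₁(0) = κ`) and `u₂ ≥ 0` even and integrable, `h > 0` on the box `Λ`, and
`Ψ = ∏ᵢ h(xᵢ) ∏_{i<j} e^{-u(xᵢ-xⱼ)/2}` (`N = n+1` bosons). With `η` the one-particle density of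
`|Ψ|²` (normalised to `1`) and `φ = √η`:
`⟨φ, γ_Ψ φ⟩ / N ≥ exp(-½ [κ - ⟨η, u₁ * η⟩ + n ⟨η, u₂ * η⟩]) ≥ exp(-½ [u₁(0) + n ‖η‖_∞ ‖u₂‖₁])`,
and `n ‖η‖_∞ ‖u₂‖₁ → ρ ‖u₂‖₁ (1 + o(1))` for asymptotically flat `η`: a soft repulsive core costs its
mean field `ρ ∫u₂`, a positive-type tail costs its self-energy, nothing else — for every `N`, `Λ`, `h`.
This covers trial states of Bijl–Dingle–Jastrow type with an integrable core factor and the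
Reatto–Chester phonon tail `u₁ ≍ (ρℓ_h)^{-1} (r² + ℓ_h²)^{-1}` (positive type, `‖u₁‖₁ = ∞`,
`u₁(0) ≍ √(ρa³)`), cf. [cite: ReattoChester1967]; complementary in class and method to Reatto's
theorem on Jastrow condensates ([cite: Reatto1969], hypotheses as restated in [cite: ZhaiWu2005, §3]).

**Kernel-checked here** (finite one-particle space `T`, sums for integrals):
`SoloInformed.sqrtDensity_occupation_ge_of_posDef_add_nonneg` (slice form: symmetric `Ψ > 0` with
slices `F(Y) h(x) exp(-½ ∑ⱼ (K₁ + K₂)(x,Yⱼ))`, `K₁` symmetric positive semi-definite with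
`K₁(x,x) ≤ κ`, `K₂ ≥ 0` pointwise), its fraction form, and the explicit product state
`SoloInformed.hybridJastrowProduct_condensateFraction_ge`. Proof = gauge form of the Jeffreys sum
+ additivity + the two pair bounds of `SoloInformedTeleportation` + the Jeffreys criterion of
`SoloInformedEntropicCriterion`. With `K₂ = 0` this is Theorem D (`SoloInformedPositiveDefiniteJastrow`)
sharpened by the smeared term `-q₁`; with `K₁ = 0` it is the entropic form of the Jastrow rung
(`SoloInformedJastrowCondensation`: there `N₀/N ≥ 1 - 6s/L - ρ b` with the flat mode and hard cores allowed).

Status: a rung (trial states), off-path for `Summit.AtomisticToContinuum.BoseEinsteinCondensation`;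
cf. [cite: PenroseOnsager1956, §5], [cite: LSSY2005, §1.2].
-/

noncomputable section

open Finset

namespace Summit.AtomisticToContinuum.BoseEinsteinCondensation.Theorems

section Hybrid

variable {T : Type*} [Fintype T] [Nonempty T] {n : ℕ}

/-- **Hybrid Jastrow slices are condensed** (Theorem D′, slice form): for symmetric `Ψ > 0` on
`T^{n+1}` with slices `Ψ(x,Y) = F(Y) h(x) exp(-½ ∑ⱼ (K₁(x,Yⱼ) + K₂(x,Yⱼ)))`, `K₁` symmetric
positive semi-definite with `K₁(x,x) ≤ κ`, `K₂ ≥ 0` pointwise, and `η` the one-particle density: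
`∑_Y (∑ₓ √η(x) Ψ(x,Y))² ≥ exp(-½ (κ - q₁ + n q₂)) ∑ Ψ²`, `qᵢ = ∑ η(y) η(x) Kᵢ(x,y)`; i.e.
`⟨√η, γ_Ψ √η⟩ / N ≥ exp(-½ (κ - q₁ + n q₂))`. -/
theorem SoloInformed.sqrtDensity_occupation_ge_of_posDef_add_nonneg
    (K₁ : T → T → ℝ) (hK₁s : ∀ x y, K₁ x y = K₁ y x)
    (hK₁ : ∀ (m : ℕ) (z : Fin m → T) (c : Fin m → ℝ), 0 ≤ ∑ i, ∑ j, c i * c j * K₁ (z i) (z j))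
    {κ : ℝ} (hκ : ∀ x, K₁ x x ≤ κ)
    (K₂ : T → T → ℝ) (hK₂ : ∀ x y, 0 ≤ K₂ x y)
    (h : T → ℝ) (hh : ∀ x, 0 < h x) (F : (Fin n → T) → ℝ) (hF : ∀ Y, 0 < F Y)
    (Ψ : (Fin (n + 1) → T) → ℝ)
    (hsymm : ∀ (σ : Equiv.Perm (Fin (n + 1))) (X : Fin (n + 1) → T), Ψ (X ∘ σ) = Ψ X)
    (hslice : ∀ (x : T) (Y : Fin n → T), Ψ (Matrix.vecCons x Y) =
      F Y * (h x * Real.exp (-(1 / 2) * ∑ j, (K₁ x (Y j) + K₂ x (Y j)))))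
    (η : T → ℝ) (hη : ∀ x, η x = (∑ Y : Fin n → T, Ψ (Matrix.vecCons x Y) ^ 2) / ∑ X, Ψ X ^ 2) :
    Real.exp (-((κ - (∑ y, η y * ∑ x, η x * K₁ x y) + n * ∑ y, η y * ∑ x, η x * K₂ x y) / 2)) *
        ∑ X, Ψ X ^ 2 ≤
      ∑ Y : Fin n → T, (∑ x, Real.sqrt (η x) * Ψ (Matrix.vecCons x Y)) ^ 2 := by
  have hg : ∀ (x : T) (Y : Fin n → T), 0 < Ψ (Matrix.vecCons x Y) := fun x Y => by
    rw [hslice]; exact mul_pos (hF Y) (mul_pos (hh x) (Real.exp_pos _))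
  refine SoloInformed.sqrtDensity_occupation_ge_of_sum_jeffreys_le Ψ hg η hη ?_
  -- gauge form: the Jeffreys sum is the teleportation sum of `W = ∑ⱼ (K₁ + K₂)`
  have hW : ∀ (x : T) (Y : Fin n → T), Real.log (Ψ (Matrix.vecCons x Y) ^ 2) =
      2 * Real.log (h x) + 2 * Real.log (F Y) -
        ((∑ j, K₁ x (Y j)) + ∑ j, K₂ x (Y j)) := by
    intro x Y
    rw [hslice, Real.log_pow, Real.log_mul (hF Y).ne' (mul_pos (hh x) (Real.exp_pos _)).ne',
      Real.log_mul (hh x).ne' (Real.exp_pos _).ne', Real.log_exp, Finset.sum_add_distrib]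
    push_cast
    ring
  rw [SoloInformed.sum_jeffreys_eq_sum_teleportation Ψ hg η hη
    (fun x Y => (∑ j, K₁ x (Y j)) + ∑ j, K₂ x (Y j)) (fun x => 2 * Real.log (h x))
    (fun Y => 2 * Real.log (F Y)) hW,
    SoloInformed.sum_teleportation_add Ψ η (fun x Y => ∑ j, K₁ x (Y j)) (fun x Y => ∑ j, K₂ x (Y j))]
  have h1 := SoloInformed.sum_teleportation_pair_le_selfEnergy K₁ hK₁s hK₁ hκ Ψ hg hsymm η hη
  have h2 := SoloInformed.sum_teleportation_pair_le_of_nonneg K₂ hK₂ Ψ hg hsymm η hη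
  linarith

/-- **Condensate-fraction form of Theorem D′**, with the cruder but kernel-free exponent
`-½ (κ + n q₂)` (`q₁ ≥ 0` dropped). -/
theorem SoloInformed.hybrid_condensateFraction_ge
    (K₁ : T → T → ℝ) (hK₁s : ∀ x y, K₁ x y = K₁ y x)
    (hK₁ : ∀ (m : ℕ) (z : Fin m → T) (c : Fin m → ℝ), 0 ≤ ∑ i, ∑ j, c i * c j * K₁ (z i) (z j))
    {κ : ℝ} (hκ : ∀ x, K₁ x x ≤ κ)
    (K₂ : T → T → ℝ) (hK₂ : ∀ x y, 0 ≤ K₂ x y)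
    (h : T → ℝ) (hh : ∀ x, 0 < h x) (F : (Fin n → T) → ℝ) (hF : ∀ Y, 0 < F Y)
    (Ψ : (Fin (n + 1) → T) → ℝ)
    (hsymm : ∀ (σ : Equiv.Perm (Fin (n + 1))) (X : Fin (n + 1) → T), Ψ (X ∘ σ) = Ψ X)
    (hslice : ∀ (x : T) (Y : Fin n → T), Ψ (Matrix.vecCons x Y) =
      F Y * (h x * Real.exp (-(1 / 2) * ∑ j, (K₁ x (Y j) + K₂ x (Y j)))))
    (η : T → ℝ) (hη : ∀ x, η x = (∑ Y : Fin n → T, Ψ (Matrix.vecCons x Y) ^ 2) / ∑ X, Ψ X ^ 2) :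
    Real.exp (-((κ + n * ∑ y, η y * ∑ x, η x * K₂ x y) / 2)) ≤
      (∑ Y : Fin n → T, (∑ x, Real.sqrt (η x) * Ψ (Matrix.vecCons x Y)) ^ 2) / ∑ X, Ψ X ^ 2 := by
  have hmain := SoloInformed.sqrtDensity_occupation_ge_of_posDef_add_nonneg K₁ hK₁s hK₁ hκ K₂ hK₂
    h hh F hF Ψ hsymm hslice η hη
  have hg : ∀ (x : T) (Y : Fin n → T), 0 < Ψ (Matrix.vecCons x Y) := fun x Y => by
    rw [hslice]; exact mul_pos (hF Y) (mul_pos (hh x) (Real.exp_pos _))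
  obtain ⟨hZpos, -, -, -⟩ := SoloInformed.density_pos_and_sum_eq_one Ψ hg η hη
  have hq₁ := SoloInformed.smearedSelfEnergy_nonneg K₁ hK₁ η
  rw [le_div_iff₀ hZpos]
  refine le_trans (mul_le_mul_of_nonneg_right (Real.exp_le_exp.2 ?_) hZpos.le) hmain
  linarith

/-- **The hybrid Bijl–Dingle–Jastrow state itself** (Theorem D′): for
`Ψ(X) = ∏ᵢ h(Xᵢ) · exp(-¼ (∑ᵢⱼ K(Xᵢ,Xⱼ) - ∑ᵢ K(Xᵢ,Xᵢ)))`, `K = K₁ + K₂`, `K₁` symmetric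
positive semi-definite with `K₁(x,x) ≤ κ`, `K₂ ≥ 0` symmetric, any `h > 0`: the condensate
fraction in the mode `√η` is at least `exp(-½ (κ + n q₂))`, `q₂ = ⟨η, K₂ η⟩`
(`≤ max_y ∑ₓ η(x) K₂(x,y) ≤ ‖η‖_∞ max_y ∑ₓ K₂(x,y)`), uniformly in `N = n+1` and in `T`. -/
theorem SoloInformed.hybridJastrowProduct_condensateFraction_ge
    (K₁ : T → T → ℝ) (hK₁s : ∀ x y, K₁ x y = K₁ y x)
    (hK₁ : ∀ (m : ℕ) (z : Fin m → T) (c : Fin m → ℝ), 0 ≤ ∑ i, ∑ j, c i * c j * K₁ (z i) (z j))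
    {κ : ℝ} (hκ : ∀ x, K₁ x x ≤ κ)
    (K₂ : T → T → ℝ) (hK₂s : ∀ x y, K₂ x y = K₂ y x) (hK₂ : ∀ x y, 0 ≤ K₂ x y)
    (h : T → ℝ) (hh : ∀ x, 0 < h x)
    (Ψ : (Fin (n + 1) → T) → ℝ)
    (hΨ : ∀ X, Ψ X = (∏ i, h (X i)) *
      Real.exp (-(1 / 4) * (∑ i, ∑ j, (K₁ (X i) (X j) + K₂ (X i) (X j)) -
        ∑ i, (K₁ (X i) (X i) + K₂ (X i) (X i)))))
    (η : T → ℝ) (hη : ∀ x, η x = (∑ Y : Fin n → T, Ψ (Matrix.vecCons x Y) ^ 2) / ∑ X, Ψ X ^ 2) :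
    Real.exp (-((κ + n * ∑ y, η y * ∑ x, η x * K₂ x y) / 2)) ≤
      (∑ Y : Fin n → T, (∑ x, Real.sqrt (η x) * Ψ (Matrix.vecCons x Y)) ^ 2) / ∑ X, Ψ X ^ 2 := by
  refine SoloInformed.hybrid_condensateFraction_ge K₁ hK₁s hK₁ hκ K₂ hK₂ h hh
    (fun Y => (∏ j, h (Y j)) *
      Real.exp (-(1 / 4) * (∑ j, ∑ k, (K₁ (Y j) (Y k) + K₂ (Y j) (Y k)) -
        ∑ j, (K₁ (Y j) (Y j) + K₂ (Y j) (Y j)))))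
    (fun Y => mul_pos (Finset.prod_pos fun j _ => hh (Y j)) (Real.exp_pos _)) Ψ ?_ ?_ η hη
  · intro σ X
    rw [hΨ, hΨ]
    have e1 : ∏ i, h ((X ∘ σ) i) = ∏ i, h (X i) := Fintype.prod_equiv σ _ _ fun i => rfl
    have e2 : ∑ i, (K₁ ((X ∘ σ) i) ((X ∘ σ) i) + K₂ ((X ∘ σ) i) ((X ∘ σ) i)) =
        ∑ i, (K₁ (X i) (X i) + K₂ (X i) (X i)) := Fintype.sum_equiv σ _ _ fun i => rfl
    have e3 : ∑ i, ∑ j, (K₁ ((X ∘ σ) i) ((X ∘ σ) j) + K₂ ((X ∘ σ) i) ((X ∘ σ) j)) =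
        ∑ i, ∑ j, (K₁ (X i) (X j) + K₂ (X i) (X j)) :=
      Fintype.sum_equiv σ _ _ fun i => Fintype.sum_equiv σ _ _ fun j => rfl
    rw [e1, e2, e3]
  · intro x Y
    have hsym1 : ∑ j : Fin n, K₁ (Y j) x = ∑ j, K₁ x (Y j) :=
      Finset.sum_congr rfl fun j _ => hK₁s _ _
    have hsym2 : ∑ j : Fin n, K₂ (Y j) x = ∑ j, K₂ x (Y j) :=
      Finset.sum_congr rfl fun j _ => hK₂s _ _
    rw [mul_mul_mul_comm, ← Real.exp_add, hΨ]
    simp only [Fin.prod_univ_succ, Fin.sum_univ_succ, Matrix.cons_val_zero, Matrix.cons_val_succ,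
      Finset.sum_add_distrib]
    rw [hsym1, hsym2]
    exact congrArg₂ (· * ·) (by ring) (congrArg Real.exp (by ring))

end Hybrid

end Summit.AtomisticToContinuum.BoseEinsteinCondensation.Theorems

end
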